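import Mathlib
import Literature.NumberTheory.Sieve.LiouvillePolynomialValues
import HarnessLib

/-!
# The Liouville function at polynomial arguments — proofs, I: the algebraic reduction of Corollary 2.1

Sibling of `Literature/NumberTheory/Sieve/LiouvillePolynomialValues.lean` (named facts of
J. Teräväinen, *On the Liouville function at polynomial arguments*, Amer. J. Math. 146 (2024)
1115–1167 = arXiv:2010.07924, cite key `Teravainen2024`).  Everything in this file is PROVED; it
introduces no definition and no named fact (D-0026), only `theorem`s supporting the (undischarged)
fact `teravainen2024_cor_2_1` (Corollary 2.1: for non-square `P` splitting over `ℚ`, each sign of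
`λ(P(n))` has positive lower density).

## What the source prints and what is proved here

Corollary 2.1 is obtained in the paper as "a special case" of Theorem 2.6 (the 99% Elliott
conjecture: `limsup_x |(1/x) ∑_{n≤x} g₁(a₁n+h₁)⋯g_k(a_kn+h_k)| ≤ 1 − δ` for unimodular multiplicative
`g_j`, `g₁` non-pretentious with values in `μ_q`, `a_i h_j ≠ a_j h_i`), §2.1 (sentence before
Corollary 2.1) and §2.2.1, last Remark after Theorem 2.6 ("it is the case `d₁ + ⋯ + d_k ≡ 0 (mod q)`
(with `q = 2`) that importantly includes Corollary 2.1 as a special case").  The special-isation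
is not spelled out in print; this file proves it (the ALGEBRAIC half of the reduction):

* `liouvilleInt_*` — the even extension `λ(m) = λ(|m|)` is completely multiplicative with
  `λ(m)² = 1` off `0` [folklore];
* `exists_eq_C_mul_sq_of_C_mul_eq` — Gauss's lemma step: `C A · P = C B · Q²` in `ℤ[x]` with
  `A ≠ 0` forces `P = C c · Q'²` [folklore; Mathlib's `Polynomial.content` / `primPart`];
* `den_mul_prod_mul_eval_eq` — clearing denominators in `P = c ∏ᵢ (x − rᵢ)`:
  `den(c) ∏_ρ den(ρ)^{k_ρ} · P(n) = num(c) ∏_ρ (den(ρ) n − num(ρ))^{k_ρ}` over the distinct roots `ρ`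
  with multiplicities `k_ρ`;
* `exists_eq_C_mul_sq_of_forall_even` — all `k_ρ` even ⟹ `P = c Q²` in `ℤ[x]`;
* `liouvilleInt_eval_eq_sign_mul_prod` — `λ(P(n)) = ε ∏_{k_ρ odd} λ(den(ρ) n − num(ρ))`;
* `exists_linearForms_of_isNonSquarePoly` — **structure lemma**: for non-square `P` splitting over
  `ℚ` there are `1 ≤ k ≤ deg P` pairwise non-proportional forms `aᵢn + bᵢ` (`aᵢ, bᵢ ≥ 1`), a sign
  `ε = ±1` and a shift `N` with `λ(P(n+N)) = ε ∏ᵢ λ(aᵢ n + bᵢ)` for all `n ∈ ℕ` — exactly the shape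
  to which Theorem 2.6 (with `g_j = λ`) applies.

The ANALYTIC half (Theorem 2.6 for `g_j = λ` ⟹ positive lower density of each sign, and the
unconditional case of at most two odd-multiplicity roots from Tao's two-point logarithmic Elliott
theorem, `LFunctions.tao_log_averaged_elliott_two_holds`) is the business of the sequel file.
Theorem 2.6 itself (entropy decrement, dense model theorem, a 99% inverse theorem along
progressions, Matomäki–Radziwiłł; §5 of the paper) is NOT in the tree; `teravainen2024_cor_2_1`
stays a named fact.

## References
* J. Teräväinen, Amer. J. Math. 146 (2024), no. 4, 1115–1167; arXiv:2010.07924: Definition 1.1,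
  Corollary 2.1, Theorem 2.6 and the Remarks after it. [Teravainen2024]
-/

namespace Literature.NumberTheory.Sieve

open Polynomial Finset

/-! ### The even extension `liouvilleInt` of `λ`: basic API -/

/-- `λ(n) = λ(n)` for `n ∈ ℕ ⊂ ℤ`. [folklore] -/
theorem liouvilleInt_natCast (n : ℕ) : liouvilleInt (n : ℤ) = ArithmeticFunction.liouville n := by
  simp [liouvilleInt]

/-- `λ(0) = 0` (Mathlib convention). [folklore] -/
theorem liouvilleInt_zero : liouvilleInt 0 = 0 := by simp [liouvilleInt]

/-- `λ(1) = 1`. [folklore] -/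
theorem liouvilleInt_one : liouvilleInt 1 = 1 := by
  simp [liouvilleInt, ArithmeticFunction.liouville_apply_one]

/-- `λ` is even. [folklore] -/
theorem liouvilleInt_neg (m : ℤ) : liouvilleInt (-m) = liouvilleInt m := by simp [liouvilleInt]

/-- `λ` is completely multiplicative on `ℤ`. [folklore] -/
theorem liouvilleInt_mul (a b : ℤ) : liouvilleInt (a * b) = liouvilleInt a * liouvilleInt b := by
  simp [liouvilleInt, Int.natAbs_mul, ArithmeticFunction.liouville_apply_mul]

/-- `λ` of a finite product. [folklore] -/
theorem liouvilleInt_prod {ι : Type*} (s : Finset ι) (f : ι → ℤ) :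
    liouvilleInt (∏ i ∈ s, f i) = ∏ i ∈ s, liouvilleInt (f i) := by
  classical
  induction s using Finset.induction_on with
  | empty => simp [liouvilleInt_one]
  | insert a s ha ih => rw [prod_insert ha, prod_insert ha, liouvilleInt_mul, ih]

/-- `λ` of a power. [folklore] -/
theorem liouvilleInt_pow (m : ℤ) (k : ℕ) : liouvilleInt (m ^ k) = liouvilleInt m ^ k := by
  induction k with
  | zero => simp [liouvilleInt_one]
  | succ k ih => rw [pow_succ, liouvilleInt_mul, ih, pow_succ]

/-- `λ(m) ∈ {1, -1}` for `m ≠ 0`. [folklore] -/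
theorem liouvilleInt_eq_one_or_eq_neg_one {m : ℤ} (hm : m ≠ 0) :
    liouvilleInt m = 1 ∨ liouvilleInt m = -1 := by
  rw [liouvilleInt, ArithmeticFunction.liouville_apply (Int.natAbs_ne_zero.2 hm)]
  exact neg_one_pow_eq_or ℤ _

/-- `λ(m)² = 1` for `m ≠ 0`. [folklore] -/
theorem liouvilleInt_mul_self {m : ℤ} (hm : m ≠ 0) : liouvilleInt m * liouvilleInt m = 1 := by
  rcases liouvilleInt_eq_one_or_eq_neg_one hm with h | h <;> simp [h]

/-- For `m ≠ 0`, `λ(m)^k` only depends on the parity of `k`. [folklore] -/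
theorem liouvilleInt_pow_eq_ite {m : ℤ} (hm : m ≠ 0) (k : ℕ) :
    liouvilleInt m ^ k = if Odd k then liouvilleInt m else 1 := by
  rcases Nat.even_or_odd k with hk | hk
  · rw [if_neg (Nat.not_odd_iff_even.2 hk)]
    obtain ⟨j, rfl⟩ := hk
    rw [← two_mul, pow_mul, sq, liouvilleInt_mul_self hm, one_pow]
  · rw [if_pos hk]
    obtain ⟨j, rfl⟩ := hk
    rw [pow_succ, pow_mul, sq, liouvilleInt_mul_self hm, one_pow, one_mul]

/-! ### Gauss's lemma step: `C A * P = C B * Q²` with `A ≠ 0` forces `P = C c * Q'²` over `ℤ` -/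

/-- If `A • P = B • Q₁²` in `ℤ[x]` with `A ≠ 0`, then `P` is an integer times a square in `ℤ[x]`
(take contents and primitive parts: Gauss's lemma). [folklore] -/
theorem exists_eq_C_mul_sq_of_C_mul_eq {P Q₁ : ℤ[X]} {A B : ℤ} (hA : A ≠ 0)
    (h : C A * P = C B * Q₁ ^ 2) : ∃ (c : ℤ) (Q : ℤ[X]), P = C c * Q ^ 2 := by
  by_cases hP : P = 0
  · exact ⟨0, 0, by simp [hP]⟩
  set q := Q₁.content with hq
  set Q₀ := Q₁.primPart with hQ₀
  set p := P.content with hp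
  set P₀ := P.primPart with hP₀
  have hQ₁ : Q₁ = C q * Q₀ := Q₁.eq_C_content_mul_primPart
  have hPd : P = C p * P₀ := P.eq_C_content_mul_primPart
  have hprim : (Q₀ ^ 2).IsPrimitive := by
    rw [sq]; exact (isPrimitive_primPart Q₁).mul (isPrimitive_primPart Q₁)
  -- rewrite the identity with contents pulled out
  have h' : C (A * p) * P₀ = C (B * q ^ 2) * Q₀ ^ 2 := by
    have := h
    rw [hPd] at this
    conv_rhs at this => rw [hQ₁]
    calc C (A * p) * P₀ = C A * (C p * P₀) := by rw [map_mul, mul_assoc]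
      _ = C B * (C q * Q₀) ^ 2 := this
      _ = C (B * q ^ 2) * Q₀ ^ 2 := by rw [mul_pow, ← map_pow, map_mul, mul_assoc]
  -- take contents: `|A p| = |B q²|`
  have hcont : normalize (A * p) = normalize (B * q ^ 2) := by
    have h1 : (C (A * p) * P₀).content = normalize (A * p) := by
      rw [content_C_mul, (isPrimitive_primPart P).content_eq_one, mul_one]
    have h2 : (C (B * q ^ 2) * Q₀ ^ 2).content = normalize (B * q ^ 2) := by
      rw [content_C_mul, hprim.content_eq_one, mul_one]
    rw [← h1, ← h2, h']
  have habs : |A * p| = |B * q ^ 2| := by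
    rw [Int.abs_eq_normalize, Int.abs_eq_normalize, hcont]
  have hp0 : p ≠ 0 := fun h0 => hP (content_eq_zero_iff.1 h0)
  have hAp : A * p ≠ 0 := mul_ne_zero hA hp0
  have hCne : (C (A * p) : ℤ[X]) ≠ 0 := by simpa using hAp
  rcases abs_eq_abs.1 habs.symm with hcase | hcase
  · -- `B q² = A p`
    rw [hcase] at h'
    have hP₀ : P₀ = Q₀ ^ 2 := mul_left_cancel₀ hCne h'
    exact ⟨p, Q₀, by rw [hPd, hP₀]⟩
  · -- `B q² = -(A p)`
    rw [hcase] at h'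
    have h'' : C (A * p) * P₀ = C (A * p) * (-(Q₀ ^ 2)) := by
      rw [h', map_neg, neg_mul, mul_neg]
    have hP₀ : P₀ = -(Q₀ ^ 2) := mul_left_cancel₀ hCne h''
    refine ⟨-p, Q₀, ?_⟩
    rw [hPd, hP₀, map_neg, neg_mul, mul_neg]

/-! ### Evaluating a split integer polynomial at integers: clearing denominators -/

section Split

variable {P : ℤ[X]} {m : ℕ} {c : ℚ} {r : Fin m → ℚ}

/-- If `P = c ∏ᵢ (x - rᵢ)` over `ℚ`, then grouping equal roots,
`P = c ∏_{ρ} (x - ρ)^{k_ρ}` with `ρ` over the distinct roots and `k_ρ` their multiplicities.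
[folklore] -/
theorem map_eq_C_mul_prod_pow (hP : P.map (Int.castRingHom ℚ) = C c * ∏ i, (X - C (r i))) :
    P.map (Int.castRingHom ℚ)
      = C c * ∏ ρ ∈ univ.image r, (X - C ρ) ^ (univ.filter (fun i => r i = ρ)).card := by
  rw [hP, Finset.prod_comp (fun ρ : ℚ => X - C ρ) r]

/-- Clearing denominators: if `P = c ∏ᵢ (x - rᵢ)` over `ℚ` then for every integer `n`,
`den(c) · ∏_ρ den(ρ)^{k_ρ} · P(n) = num(c) · ∏_ρ (den(ρ) n − num(ρ))^{k_ρ}` in `ℤ`. [folklore] -/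
theorem den_mul_prod_mul_eval_eq
    (hP : P.map (Int.castRingHom ℚ) = C c * ∏ i, (X - C (r i))) (n : ℤ) :
    (c.den : ℤ) * (∏ ρ ∈ univ.image r, (ρ.den : ℤ) ^ (univ.filter (fun i => r i = ρ)).card)
        * P.eval n
      = c.num * ∏ ρ ∈ univ.image r,
          ((ρ.den : ℤ) * n - ρ.num) ^ (univ.filter (fun i => r i = ρ)).card := by
  set R := univ.image r with hR
  set k : ℚ → ℕ := fun ρ => (univ.filter (fun i => r i = ρ)).card with hk
  apply Int.cast_injective (α := ℚ)
  have hev : ((P.eval n : ℤ) : ℚ) = c * ∏ ρ ∈ R, ((n : ℚ) - ρ) ^ k ρ := by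
    have h1 := eval_intCast_map (Int.castRingHom ℚ) P n
    simp only [Int.cast_id, eq_intCast] at h1
    rw [← h1, map_eq_C_mul_prod_pow hP, eval_mul, eval_C, eval_prod]
    simp only [eval_pow, eval_sub, eval_X, eval_C, hR, hk]
  have key : ∀ ρ : ℚ, (ρ.den : ℚ) * ((n : ℚ) - ρ) = (ρ.den : ℚ) * n - ρ.num := by
    intro ρ
    rw [mul_sub, mul_comm (ρ.den : ℚ) ρ, Rat.mul_den_eq_num]
  have hprod : (∏ ρ ∈ R, (ρ.den : ℚ) ^ k ρ) * (∏ ρ ∈ R, ((n : ℚ) - ρ) ^ k ρ)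
      = ∏ ρ ∈ R, ((ρ.den : ℚ) * n - ρ.num) ^ k ρ := by
    rw [← prod_mul_distrib]
    refine prod_congr rfl fun ρ _ => ?_
    rw [← mul_pow, key]
  push_cast
  rw [hev]
  calc (c.den : ℚ) * (∏ ρ ∈ R, (ρ.den : ℚ) ^ k ρ) * (c * ∏ ρ ∈ R, ((n : ℚ) - ρ) ^ k ρ)
      = (c * c.den) * ((∏ ρ ∈ R, (ρ.den : ℚ) ^ k ρ) * ∏ ρ ∈ R, ((n : ℚ) - ρ) ^ k ρ) := by ring
    _ = c.num * ∏ ρ ∈ R, ((ρ.den : ℚ) * n - ρ.num) ^ k ρ := by rw [Rat.mul_den_eq_num, hprod]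

/-- If every distinct rational root of the split polynomial `P = c ∏ᵢ (x - rᵢ)` has even
multiplicity, then `P = c' Q²` in `ℤ[x]` (clearing denominators and Gauss's lemma). [folklore] -/
theorem exists_eq_C_mul_sq_of_forall_even
    (hP : P.map (Int.castRingHom ℚ) = C c * ∏ i, (X - C (r i)))
    (heven : ∀ ρ ∈ univ.image r, Even ((univ.filter (fun i => r i = ρ)).card)) :
    ∃ (c' : ℤ) (Q : ℤ[X]), P = C c' * Q ^ 2 := by
  set R := univ.image r with hR
  set k : ℚ → ℕ := fun ρ => (univ.filter (fun i => r i = ρ)).card with hk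
  set Qq : ℚ[X] := ∏ ρ ∈ R, (X - C ρ) ^ (k ρ / 2) with hQq
  have hQq2 : Qq ^ 2 = ∏ ρ ∈ R, (X - C ρ) ^ k ρ := by
    rw [hQq, ← prod_pow]
    refine prod_congr rfl fun ρ hρ => ?_
    rw [← pow_mul, Nat.div_mul_cancel (heven ρ hρ).two_dvd]
  have hPq : P.map (Int.castRingHom ℚ) = C c * Qq ^ 2 := by
    rw [hQq2, map_eq_C_mul_prod_pow hP]
  obtain ⟨b, hbM, hb⟩ := IsLocalization.integerNormalization_spec (nonZeroDivisors ℤ) Qq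
  set Q₁ : ℤ[X] := IsLocalization.integerNormalization (nonZeroDivisors ℤ) Qq with hQ₁
  have hb0 : b ≠ 0 := mem_nonZeroDivisors_iff_ne_zero.1 hbM
  rw [algebraMap_int_eq] at hb
  have hbQ : Q₁.map (Int.castRingHom ℚ) = C (b : ℚ) * Qq := by
    rw [hb, Algebra.smul_def]
    simp
  -- the identity `C (den c * b²) * P = C (num c) * Q₁²` holds after mapping to `ℚ[x]`
  have hId : C ((c.den : ℤ) * b ^ 2) * P = C c.num * Q₁ ^ 2 := by
    apply map_injective (Int.castRingHom ℚ) Int.cast_injective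
    rw [Polynomial.map_mul, Polynomial.map_mul, map_C, map_C, Polynomial.map_pow, hbQ, hPq]
    simp only [eq_intCast, Int.cast_mul, Int.cast_pow, Int.cast_natCast]
    rw [← Rat.mul_den_eq_num c]
    simp only [map_mul, map_pow, mul_pow]
    ring
  have hA : (c.den : ℤ) * b ^ 2 ≠ 0 := mul_ne_zero (by exact_mod_cast c.den_ne_zero) (pow_ne_zero _ hb0)
  exact exists_eq_C_mul_sq_of_C_mul_eq hA hId


/-- **The Liouville identity for a split polynomial.** If `P = c ∏ᵢ (x - rᵢ)` over `ℚ`, then at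
every integer `n` where all cleared linear factors `den(ρ) n − num(ρ)` are non-zero,
`λ(P(n)) = ε · ∏_{ρ : k_ρ odd} λ(den(ρ) n − num(ρ))` with the sign
`ε = λ(den c) λ(∏_ρ den(ρ)^{k_ρ}) λ(num c)` independent of `n` (complete multiplicativity of `λ`
and `λ² = 1`). This is the step "Corollary 2.1 is the special case `g_j = λ` of Theorem 2.6" of
Teräväinen 2024, §2.1–2.2.
[cite: Teravainen2024, §2.1 (sentence before Corollary 2.1) and Remarks after Theorem 2.6] -/
theorem liouvilleInt_eval_eq_sign_mul_prod
    (hP : P.map (Int.castRingHom ℚ) = C c * ∏ i, (X - C (r i))) (n : ℤ)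
    (hn : ∀ ρ ∈ univ.image r, (ρ.den : ℤ) * n - ρ.num ≠ 0) :
    liouvilleInt (P.eval n)
      = (liouvilleInt c.den
          * liouvilleInt (∏ ρ ∈ univ.image r, (ρ.den : ℤ) ^ (univ.filter (fun i => r i = ρ)).card)
          * liouvilleInt c.num)
        * ∏ ρ ∈ (univ.image r).filter (fun ρ => Odd ((univ.filter (fun i => r i = ρ)).card)),
            liouvilleInt ((ρ.den : ℤ) * n - ρ.num) := by
  set D : ℤ := ∏ ρ ∈ univ.image r, (ρ.den : ℤ) ^ (univ.filter (fun i => r i = ρ)).card with hDdef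
  have hD : D ≠ 0 :=
    prod_ne_zero_iff.2 fun ρ _ => pow_ne_zero _ (by exact_mod_cast ρ.den_ne_zero)
  have hden : (c.den : ℤ) ≠ 0 := by exact_mod_cast c.den_ne_zero
  have hL : liouvilleInt c.den * liouvilleInt D * liouvilleInt (P.eval n)
      = liouvilleInt c.num * ∏ ρ ∈ univ.image r,
          liouvilleInt (((ρ.den : ℤ) * n - ρ.num) ^ (univ.filter (fun i => r i = ρ)).card) := by
    rw [← liouvilleInt_prod, ← liouvilleInt_mul, ← liouvilleInt_mul, ← liouvilleInt_mul]
    exact congrArg liouvilleInt (den_mul_prod_mul_eval_eq hP n)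
  have hpar : ∏ ρ ∈ univ.image r,
        liouvilleInt (((ρ.den : ℤ) * n - ρ.num) ^ (univ.filter (fun i => r i = ρ)).card)
      = ∏ ρ ∈ (univ.image r).filter (fun ρ => Odd ((univ.filter (fun i => r i = ρ)).card)),
          liouvilleInt ((ρ.den : ℤ) * n - ρ.num) := by
    rw [prod_filter]
    refine prod_congr rfl fun ρ hρ => ?_
    rw [liouvilleInt_pow, liouvilleInt_pow_eq_ite (hn ρ hρ)]
  rw [hpar] at hL
  have h1 := liouvilleInt_mul_self hden
  have h2 := liouvilleInt_mul_self hD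
  calc liouvilleInt (P.eval n)
      = (liouvilleInt c.den * liouvilleInt c.den) * (liouvilleInt D * liouvilleInt D)
          * liouvilleInt (P.eval n) := by rw [h1, h2, one_mul, one_mul]
    _ = liouvilleInt c.den * liouvilleInt D
          * (liouvilleInt c.den * liouvilleInt D * liouvilleInt (P.eval n)) := by ring
    _ = _ := by rw [hL]; ring

/-- Positivity of the cleared linear factors beyond the shift `N = 1 + ∑_ρ |num ρ|`:
for `n ≥ N`, `den(ρ) n − num(ρ) ≥ 1` for every root `ρ`. [folklore] -/
theorem one_le_den_mul_sub_num {ρ : ℚ} (hρ : ρ ∈ univ.image r) {n : ℤ}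
    (hn : (1 : ℤ) + ∑ σ ∈ univ.image r, (σ.num.natAbs : ℤ) ≤ n) :
    1 ≤ (ρ.den : ℤ) * n - ρ.num := by
  have h1 : (ρ.num.natAbs : ℤ) ≤ ∑ σ ∈ univ.image r, (σ.num.natAbs : ℤ) :=
    single_le_sum (f := fun σ : ℚ => (σ.num.natAbs : ℤ)) (fun _ _ => by positivity) hρ
  have h2 : ρ.num ≤ (ρ.num.natAbs : ℤ) := Int.le_natAbs
  have h0 : (0 : ℤ) ≤ n := by
    have : (0 : ℤ) ≤ ∑ σ ∈ univ.image r, (σ.num.natAbs : ℤ) := sum_nonneg fun _ _ => by positivity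
    linarith
  have h3 : n ≤ (ρ.den : ℤ) * n :=
    le_mul_of_one_le_left h0 (by exact_mod_cast ρ.den_pos)
  linarith

end Split

/-! ### The structure lemma: `λ(P(n + N)) = ε ∏ᵢ λ(aᵢ n + bᵢ)` -/

/-- **Structure lemma (reduction of Corollary 2.1 to correlations of `λ` along linear forms).**
Let `P ∈ ℤ[x]` be non-square (Definition 1.1) and split into linear factors over `ℚ`. Then there
are `k ≥ 1` (at most `deg P`) linear forms `aᵢ n + bᵢ` with `aᵢ, bᵢ ≥ 1`, pairwise
non-proportional (`aᵢ bⱼ ≠ aⱼ bᵢ`), a sign `ε ∈ {±1}` and a shift `N` such that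
`λ(P(n + N)) = ε ∏ᵢ λ(aᵢ n + bᵢ)` for every `n ∈ ℕ`. (The forms are the cleared factors
`den(ρ)·x − num(ρ)` at the distinct rational roots `ρ` of ODD multiplicity, shifted by
`N = 1 + ∑_ρ |num ρ|`; `k ≥ 1` because if every multiplicity were even, clearing denominators and
Gauss's lemma would write `P = c Q²` in `ℤ[x]`, contradicting non-squareness.) This is the
content of "Corollary 2.1 follows as a special case [of Theorem 2.6, `g_j = λ`, `q = 2`,
`d₁ + ⋯ + d_k ≡ 0 (mod 2)` allowed]" in Teräväinen 2024, §2.1 and the last Remark after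
Theorem 2.6. [cite: Teravainen2024, §2.1 (before Corollary 2.1) and §2.2.1 (Remarks after Theorem 2.6)] -/
theorem exists_linearForms_of_isNonSquarePoly {P : ℤ[X]} (hns : IsNonSquarePoly P)
    (hsp : FactorsIntoLinearFactorsOverRat P) :
    ∃ (k : ℕ) (a b : Fin k → ℕ) (ε : ℤ) (N : ℕ),
      1 ≤ k ∧ k ≤ P.natDegree ∧ (∀ i, 1 ≤ a i) ∧ (∀ i, 1 ≤ b i) ∧
      (∀ i j, i ≠ j → a i * b j ≠ a j * b i) ∧ (ε = 1 ∨ ε = -1) ∧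
      ∀ n : ℕ, liouvilleInt (P.eval ((n : ℤ) + N))
        = ε * ∏ i, (ArithmeticFunction.liouville (a i * n + b i) : ℤ) := by
  classical
  obtain ⟨m, c, r, hP⟩ := hsp
  set S := (univ.image r).filter (fun ρ => Odd ((univ.filter (fun i => r i = ρ)).card)) with hS
  set Nz : ℕ := 1 + ∑ ρ ∈ univ.image r, ρ.num.natAbs with hNz
  set D : ℤ := ∏ ρ ∈ univ.image r, (ρ.den : ℤ) ^ (univ.filter (fun i => r i = ρ)).card with hDdef
  have hcast : (1 : ℤ) + ∑ σ ∈ univ.image r, (σ.num.natAbs : ℤ) = (Nz : ℤ) := by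
    rw [hNz]; push_cast; rfl
  have hP0 : P ≠ 0 := by
    intro h0
    have := hns.1
    rw [h0, leadingCoeff_zero] at this
    exact lt_irrefl _ this
  have hc : c ≠ 0 := by
    intro h0
    rw [h0, map_zero, zero_mul, Polynomial.map_eq_zero_iff (Int.castRingHom ℚ).injective_int] at hP
    exact hP0 hP
  -- `S` is nonempty: otherwise `P` would be `c' Q²` in `ℤ[x]`
  have hSne : S.Nonempty := by
    by_contra hempty
    rw [not_nonempty_iff_eq_empty, hS, filter_eq_empty_iff] at hempty
    obtain ⟨c', Q, hQ⟩ := exists_eq_C_mul_sq_of_forall_even hP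
      (fun ρ hρ => Nat.not_odd_iff_even.1 (hempty hρ))
    exact hns.2 ⟨c', Q, hQ⟩
  -- enumerate `S`
  set e := S.equivFin with he
  have hmemR : ∀ i : Fin S.card, (e.symm i).1 ∈ univ.image r := fun i =>
    (mem_filter.1 (e.symm i).2).1
  have hb1 : ∀ i : Fin S.card, 1 ≤ ((e.symm i).1.den : ℤ) * Nz - (e.symm i).1.num := fun i =>
    one_le_den_mul_sub_num (hmemR i) hcast.le
  refine ⟨S.card, fun i => (e.symm i).1.den,
    fun i => (((e.symm i).1.den : ℤ) * Nz - (e.symm i).1.num).toNat,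
    liouvilleInt c.den * liouvilleInt D * liouvilleInt c.num, Nz,
    hSne.card_pos, ?_, fun i => (e.symm i).1.den_pos, ?_, ?_, ?_, ?_⟩
  · -- `#S ≤ deg P = m`
    have hdeg : P.natDegree = m := by
      rw [← natDegree_map_eq_of_injective (Int.castRingHom ℚ).injective_int P, hP,
        natDegree_C_mul hc, natDegree_prod_of_monic _ _ fun i _ => monic_X_sub_C (r i)]
      simp
    rw [hdeg]
    calc S.card ≤ (univ.image r).card := card_filter_le _ _
      _ ≤ (univ : Finset (Fin m)).card := card_image_le
      _ = m := by simp
  · -- `bᵢ ≥ 1`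
    intro i
    have := hb1 i
    show (1 : ℕ) ≤ (((e.symm i).1.den : ℤ) * Nz - (e.symm i).1.num).toNat
    omega
  · -- pairwise non-proportional
    intro i j hij hEq
    have hρ : (e.symm i).1 ≠ (e.symm j).1 := fun h =>
      hij (e.symm.injective (Subtype.ext h))
    have hi1 := hb1 i
    have hj1 := hb1 j
    have hEqZ := congrArg (fun t : ℕ => (t : ℤ)) hEq
    simp only [Nat.cast_mul] at hEqZ
    rw [Int.toNat_of_nonneg (by omega), Int.toNat_of_nonneg (by omega)] at hEqZ
    apply hρ
    rw [Rat.eq_iff_mul_eq_mul]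
    linear_combination hEqZ
  · -- `ε = ±1`
    have hD : D ≠ 0 :=
      prod_ne_zero_iff.2 fun ρ _ => pow_ne_zero _ (by exact_mod_cast ρ.den_ne_zero)
    have hu : ∀ z : ℤ, z ≠ 0 → IsUnit (liouvilleInt z) := fun z hz => by
      rcases liouvilleInt_eq_one_or_eq_neg_one hz with h | h <;> simp [h]
    have hden : (c.den : ℤ) ≠ 0 := by exact_mod_cast c.den_ne_zero
    exact Int.isUnit_iff.1 (((hu _ hden).mul (hu D hD)).mul (hu _ (Rat.num_ne_zero.2 hc)))
  · -- the identity
    intro n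
    have hnN : (1 : ℤ) + ∑ σ ∈ univ.image r, (σ.num.natAbs : ℤ) ≤ (n : ℤ) + Nz := by
      rw [hcast]; omega
    have hne : ∀ ρ ∈ univ.image r, (ρ.den : ℤ) * ((n : ℤ) + Nz) - ρ.num ≠ 0 := fun ρ hρ => by
      have := one_le_den_mul_sub_num hρ hnN
      omega
    rw [liouvilleInt_eval_eq_sign_mul_prod hP ((n : ℤ) + Nz) hne]
    congr 1
    rw [← prod_coe_sort S]
    refine Fintype.prod_equiv e _ _ fun ρ => ?_
    have h1 := hb1 (e ρ)
    simp only [Equiv.symm_apply_apply] at h1 ⊢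
    rw [← liouvilleInt_natCast]
    congr 1
    push_cast
    rw [Int.toNat_of_nonneg (by omega)]
    ring

end Literature.NumberTheory.Sieve
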